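import Summits.RiemannHypothesis.RiemannHypothesis.Theses.SpectralTrace
import Summits.RiemannHypothesis.RiemannHypothesis.Theorems.WindowTraceArch.Negative.UnitMass
import Summits.RiemannHypothesis.RiemannHypothesis.Theorems.WindowTraceArch.Negative.LocalWeyl
import Summits.RiemannHypothesis.RiemannHypothesis.Theorems.WindowStep.Negative.Collapse
import Summits.RiemannHypothesis.RiemannHypothesis.Theorems.WindowStep.Negative.LoadBearing
import Summits.RiemannHypothesis.RiemannHypothesis.Theorems.SpectralTraceWindowTraceToPositivity
import Summits.RiemannHypothesis.RiemannHypothesis.Theorems.WeilWindowFlowGronwallLeakageStrictAnti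
import Summits.RiemannHypothesis.RiemannHypothesis.Theorems.SpectralTraceWindowStepStubUpperLawUniform
import Summits.RiemannHypothesis.RiemannHypothesis.Theorems.SpectralTraceWindowStepStubArchFloor
import Summits.RiemannHypothesis.RiemannHypothesis.Theorems.SpectralTraceWindowStepStubFarTail
import Literature.NumberTheory.LFunctions.WeilDilationVirialDeriv
import Literature.NumberTheory.LFunctions.WeilFirstPrimePositivityC
import HarnessLib

/-!
# Line `christoffel-margin` for the crux `WindowStep` (stmt-RiemannHypothesis-14659)
# — factor the step through Weil positivity ONE RUNG AHEAD (crux-plan, round 2)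

Crux (route decl, FIXED): `Summit.RiemannHypothesis.RiemannHypothesis.Theses.SpectralTrace.WindowStep`
`= ∀ n ≥ 2, Trace(log n) → Trace(log (n+1))`, `Trace(A)` = some real unit-multiplicity family `γ`
reproduces `W = weilFunctional` on the Weil tests supported in `[-A, A]`.
Idea card: `Cruxes/WindowStep/Ideas/christoffel-margin.md` (ideator 5, `SketchIdeator5.lean`); triage
`TRIAGE-r2-1.md`, `TRIAGE-r2-2.md` (both pass; sharpenings answered below).

## THE SITUATION (kernel-checked in the tree)

`WindowStep ↔ (WindowTraceArch → RH)` (`Theorems/WindowStep/Negative/Collapse.lean`), so every honest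
line is an EXACT CONJUNCTION `WindowStep ↔ X ∧ Y` with `X`, `Y` each crux-implied, of different type,
neither alone the crux (TRIAGE-r2-2, panel note). The two lines that died used the rung hypothesis
through positivity only (`Sketch`: held stub `≡ RH`) or not at all (`floor-feedback`: held stub
`= ladder ≡ RH`, numerically false at the seed). This line consumes the rung-`n` UNIT family in the
currency the dead-line notes asked for — Christoffel room read ACROSS levels — and cuts the crux at
"where does the integer ladder die relative to the conjugate point `a⋆`": two rungs early (`U`) or
not (`PositiveLadder`).

## THE STUBS (3 registered; `sorry` lives only in `stub_*`)

* `stub_rungCorridor` (RH-FREE, M–L, provable now; SHARED with line `ground-state-pinning`'s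
  `GapLemma` input as ONE registered statement, per TRIAGE-r2-1 sharpen (b) / TRIAGE-r2-2): the
  LOWER local Weyl law for rung families — for every window `A > 0` there are `R, c > 0`, `C` with
  `c·log(1+|T|) − C ≤ #{i : |γ_i − T| ≤ R}` for EVERY real family `γ` reproducing `W` on `[-A, A]`
  and every height `T`. (The UPPER law `#{i : |γ_i − T| ≤ 1} ≤ C(1 + log(1+|T|))` is LANDED:
  `card_near_le_log_of_windowTrace`; only "cells get arbitrarily crowded" is landed on the lower
  side: `Negative/BoundedDensity.lean`.) Proof route: test the identity against the modulated
  autocorrelation `h_T ⋆ h̃_T` of a fixed `h` supported in `[-A/2, A/2]`: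
  `Σ_i |ĥ(γ_i − T)|² = Re Q(h_T) ≥ ‖h‖₂² log(1+|T|) − K(h, A)` (lower Stirling bound for
  `Re ψ(1/4 + iu/2)`, bounded polar term `2e^{A/2}‖h‖₁²`, prime term `≤ 2ψ(e^A)·sup|k|`), then remove
  the atoms beyond radius `R` with the landed upper law and the decay of `ĥ`.
* `stub_unitMargin` (RH-IMPLIED threshold claim, the card's `U`, fed the corridor): for every
  `n ≥ 2`, a rung-`(log n)` family forces `WeilPositivityOn (log (n+2) / 2)` — one full rung beyond
  what Bochner gives for free (`windowTraceToPositivity_proof`: `log n / 2`). Mechanism: the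
  Christoffel squeeze `squeeze_hasSum` / `negativity_squeezes_atoms` (PROVED below: a negative
  direction `h` one collar up forces `Σ_i ‖(h_η)^(1/2+iγ_i)‖² < ∫₀^η virial` on EVERY rung-`n`
  family) raced against the corridor and the pinning of atoms below the unit wall `2πn`. Honest
  status (TRIAGE-r2-1/2): in the threshold model of `Arch ∧ ¬RH` it reads `N‡ + 2 ≤ e^{2a⋆}`
  (`N‡` = last integer rung, `a⋆` = conjugate point); it implies card 4's `NoDegenerateEdge`
  (`no_conjugatePoint_of_unitCertifiesMargin` below is the one-line shadow); its surplus lives in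
  the Newman regime and is priced by the card's unrun experiment F2 (order of unit-death vs
  positivity-death). NOT `≥ (Arch → RH)`: with `WindowTraceArch` it yields `WeilPositivityOn (log 2)`
  and nothing more (`unitCertifiesMargin_windowTraceArch`).
* `stub_positiveLadder` (RH-STRENGTH synthesis, HARDEST; the card's `C′ = MarginRecrystallisation`
  RE-TYPED HONESTLY per TRIAGE-r2-1 F2 / sharpen (a), kernel-checked equivalent below:
  `marginRecrystallisation_iff_positiveLadder`): for every `n ≥ 2`, from the SEED `WindowTraceArch`
  and Weil positivity half a rung beyond the target, `WeilPositivityOn (log (n+1) / 2)`, a rung-`n`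
  family. This is the sibling cruxes' crystallisation-from-positivity at every integer rung with
  one rung of positivity to spare (`n = 2`: trivial; `n = 3`: `WindowTracePrime2` from
  `WeilPositivityOn (log 2)`, `windowTracePrime2_of_positiveLadder`); the old family is NOT an input
  (BothWays: consecutive witnesses share no cofinite sub-family). NOT `≥ (Arch → RH)`: it needs
  positivity inputs beyond the certified `log 3 / 2` (`weilPositivityOn_log_three_half`).

## THE COMPOSITION `WindowStep_of` (kernel-checked, no `sorry` outside `stub_*`)

`Trace(log n)` ⟹ (`stub_unitMargin` fed `stub_rungCorridor`) `WeilPositivityOn (log (n+2)/2)`;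
`Trace(log n)` ⟹ (`seed_of_rung`) `WindowTraceArch`; `stub_positiveLadder (n+1)` ⟹ `Trace(log (n+1))`.
Per `n`, two function applications; no passage through RH, `spectralThesis_of_riemannHypothesis`
or `riemannHypothesis_iff_positivityStep` (contrast `Lines/Sketch.lean`, `SketchIdeator2`).

## DISPROOF USED (`Cruxes/WindowStep/Disproof.lean` v2, read 2026-08-16T21:3xZ)

§0 Collapse — honoured by construction: the line is an EXACT conjunction
`WindowStep ↔ UnitCertifiesMargin ∧ PositiveLadder` (`windowStep_iff_unitCertifiesMargin_and_positiveLadder`,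
sorry-free), both RH-bearing stubs crux-implied (`unitCertifiesMargin_of_windowStep`,
`positiveLadder_of_windowStep`), neither alone the crux. §1 (H1) the binder `2 ≤ n` carries NO
weight inside either stub (at `n = 0, 1` `stub_unitMargin` asserts the CERTIFIED
`WeilPositivityOn (log 2 / 2)`, `(log 3 / 2)` and `stub_positiveLadder` the free `Trace(0)`,
`windowTrace_of_nonpos`); H1's content — the seed is worth exactly `WindowTraceArch` — is honoured
STRUCTURALLY: `stub_positiveLadder` takes the seed as an INPUT, so the factorisation at `n = 1`
(`Trace(0) → Trace(log 2)`) is circular and never a free proof of the seed. (H2) the rung hypothesis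
is CONSUMED — by `stub_unitMargin` essentially (the unit family, not its positivity shadow) and by
`stub_positiveLadder` as the seed (`seed_of_rung`); (H3) n/a (conclusions are a positivity level /
one rung). §2/§5/BelowHeight (`step_not_by_extension|deletion|finite_moves|below_height|
cofinite_matching`, `step_infinite_unmatched|unadded`, `no_windowStep_of_matched_above_height`)
constrain the ENGINES of `stub_positiveLadder` only — it claims no finite / one-sided / local
rework (it does not even take the old family). §3 `EngineKill` not invoked. §4 (line `Sketch`):
this composition does not route through `riemannHypothesis_iff_positivityStep`. No stub is an
instance of a landed Negative lemma; `ledger negatives --problem RiemannHypothesis` = 1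
(UniversalFactor Laplace loophole), unrelated.
-/

set_option linter.dupNamespace false

noncomputable section

open Complex Set MeasureTheory
open scoped Real Topology

namespace Summit.RiemannHypothesis.RiemannHypothesis.Cruxes.WindowStep.ChristoffelMargin

open Literature.NumberTheory.LFunctions
open Summit.RiemannHypothesis.RiemannHypothesis.Theses.SpectralTrace
open Summit.RiemannHypothesis.RiemannHypothesis.Theorems.WindowTraceArch.Negative
open Summit.RiemannHypothesis.RiemannHypothesis.Theorems.WindowStep.Negative
open Summit.RiemannHypothesis.RiemannHypothesis.Theorems.WeilWindowFlowGronwallLeakage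

/-- `Trace(A)` (file-local notation, as in `Negative/Collapse.lean`). -/
local notation3 "WTrace " A:max => ∃ (ι : Type) (γ : ι → ℝ), ∀ g : ℝ → ℂ, IsWeilTest g →
  tsupport g ⊆ Set.Icc (-A) A →
    HasSum (fun i => weilMellin g (1 / 2 + (γ i : ℂ) * I)) (weilFunctional g)

/-! ## The statements -/

/-- Statement of `stub_rungCorridor`: the LOWER local Weyl law for window-trace families, with
constants depending on the window only. -/
def RungCorridorStatement : Prop :=
  ∀ A : ℝ, 0 < A → ∃ R c C : ℝ, 0 < R ∧ 0 < c ∧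
    ∀ (ι : Type) (γ : ι → ℝ),
      (∀ g : ℝ → ℂ, IsWeilTest g → tsupport g ⊆ Icc (-A) A →
        HasSum (fun i => weilMellin g (1 / 2 + (γ i : ℂ) * I)) (weilFunctional g)) →
      ∀ T : ℝ, ∃ s : Finset ι, (∀ i ∈ s, |γ i - T| ≤ R) ∧
        c * Real.log (1 + |T|) - C ≤ (s.card : ℝ)

/-- **U — unit atoms certify a positivity margin** (the card's `UnitCertifiesMargin`): a rung-`n`
family forces Weil positivity on the half window of rung `n + 2`. -/
def UnitCertifiesMargin : Prop :=
  ∀ n : ℕ, 2 ≤ n → (WTrace (Real.log (n : ℝ))) →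
    WeilPositivityOn (Real.log ((n : ℝ) + 2) / 2)

/-- Statement of `stub_unitMargin`: `U` fed the corridor. -/
def UnitMarginStatement : Prop :=
  RungCorridorStatement → UnitCertifiesMargin

/-- **C′ — re-crystallisation under a positivity margin** (the card's `MarginRecrystallisation`,
kept for the record; the registered stub is its honest re-typing `PositiveLadder`). -/
def MarginRecrystallisation : Prop :=
  ∀ n : ℕ, 2 ≤ n → (WTrace (Real.log (n : ℝ))) →
    WeilPositivityOn (Real.log ((n : ℝ) + 2) / 2) → WTrace (Real.log ((n : ℝ) + 1))

/-- Statement of `stub_positiveLadder`: from the seed and Weil positivity half a rung beyond the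
target, a rung-`n` family (TRIAGE-r2-1 F2's `PositiveLadder`). -/
def PositiveLadder : Prop :=
  ∀ n : ℕ, 2 ≤ n → WindowTraceArch →
    WeilPositivityOn (Real.log ((n : ℝ) + 1) / 2) → WTrace (Real.log (n : ℝ))

/-! ## Vocabulary: the Weil–Christoffel function (names the line; used by `one_le_weilChristoffel_of_atom`) -/

/-- The Weil–Christoffel function at window `A` and height `t`:
`λ_A(t) := inf { Re Q(h) : h Weil test, supp h ⊆ [-A/2, A/2], ĥ(1/2+it) = 1 }` — the maximal mass a
positive representing measure of `W` on `(-A, A)` can place at `t` (Akhiezer, The Classical Moment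
Problem, Thm 2.5.2, continual analogue). Antitone in `A` (infimum over a larger set); a unit atom at
`t` needs `λ_A(t) ≥ 1` (`one_le_weilChristoffel_of_atom`). Real `sInf`: junk value `0` if the set
is unbounded below (positivity fails on the half window). -/
def weilChristoffel (A t : ℝ) : ℝ :=
  sInf {x : ℝ | ∃ h : ℝ → ℂ, IsWeilTest h ∧ tsupport h ⊆ Icc (-(A / 2)) (A / 2) ∧
    weilMellin h (1 / 2 + (t : ℂ) * I) = 1 ∧ x = (weilQuadratic h).re}

/-! ## The registered stubs (signatures spelled out verbatim; `sorry` lives only here)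

RESHAPE (lead a1, cycle 1): the corridor `stub_rungCorridor` (M–L in one piece) is cut at the skeleton
level into three worker-sized RH-FREE stubs — `stub_upperLawUniform` (the landed upper law with its
constant quantified BEFORE the family, a re-quantification of `card_near_le_log_of_windowTrace`),
`stub_archFloor` (the archimedean floor `Re Q(w_T) ≥ (P/2π) log(1+|T|) − K` for the modulates of a
narrow test) and `stub_farTail` (atoms farther than `R` from `T` contribute `≤ ε(1 + log(1+|T|))`,
fed the uniform upper law) — and `stub_rungCorridor` is PROVED from them below
(`rungCorridor_of_pieces`, sorry-free glue: HasSum partial sums + near/far split), with its statement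
kept verbatim (it is `stub_unitMargin`'s hypothesis and the GapLemma input of `ground-state-pinning`). -/

/-- Statement of `stub_upperLawUniform`: the UPPER local Weyl law with a constant depending on the
window only (quantified before the family). -/
def UpperLawUniformStatement : Prop :=
  ∀ A : ℝ, 0 < A → ∃ C : ℝ, 0 < C ∧
    ∀ (ι : Type) (γ : ι → ℝ),
      (∀ g : ℝ → ℂ, IsWeilTest g → tsupport g ⊆ Icc (-A) A →
        HasSum (fun i => weilMellin g (1 / 2 + (γ i : ℂ) * I)) (weilFunctional g)) →
      ∀ (T : ℝ) (s : Finset ι), (∀ i ∈ s, |γ i - T| ≤ 1) →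
        (s.card : ℝ) ≤ C * (1 + Real.log (1 + |T|))

/-- Statement of `stub_archFloor`: the archimedean floor of `Re Q` along the modulates of a narrow
test (`P = ∫ |ŵ(1/2+iv)|² dv`). -/
def ArchFloorStatement : Prop :=
  ∀ w : ℝ → ℂ, IsWeilTest w → tsupport w ⊆ Icc (-(Real.log 2 / 2)) (Real.log 2 / 2) →
    ∃ K : ℝ, ∀ T : ℝ,
      1 / (2 * Real.pi) * (∫ v : ℝ, ‖weilMellin w (1 / 2 + v * I)‖ ^ 2) * Real.log (1 + |T|) - K ≤
        (weilQuadratic (fun t : ℝ => Complex.exp (-((T * t : ℝ) : ℂ) * I) * w t)).re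

/-- Statement of `stub_farTail`: fed the uniform upper law, the atoms at distance `> R` from `T`
carry at most `ε (1 + log(1+|T|))` of the squared transform of a fixed test, for `R = R(A, w, ε)`. -/
def FarTailStatement : Prop :=
  UpperLawUniformStatement →
    ∀ A : ℝ, 0 < A → ∀ w : ℝ → ℂ, IsWeilTest w → ∀ ε : ℝ, 0 < ε → ∃ R : ℝ, 0 < R ∧
      ∀ (ι : Type) (γ : ι → ℝ),
        (∀ g : ℝ → ℂ, IsWeilTest g → tsupport g ⊆ Icc (-A) A →
          HasSum (fun i => weilMellin g (1 / 2 + (γ i : ℂ) * I)) (weilFunctional g)) →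
        ∀ (T : ℝ) (F : Finset ι), (∀ i ∈ F, R < |γ i - T|) →
          ∑ i ∈ F, ‖weilMellin w (1 / 2 + ((γ i - T : ℝ) : ℂ) * I)‖ ^ 2 ≤
            ε * (1 + Real.log (1 + |T|))

/-- **stub_upperLawUniform — the upper local Weyl law, constant uniform in the family (RH-FREE, S).**
For every `A > 0` there is `C > 0` such that EVERY real family `γ` reproducing `W` on the Weil tests
supported in `[-A, A]` has at most `C (1 + log(1+|T|))` indices in any unit window `[T-1, T+1]`.
This is `card_near_le_log_of_windowTrace` (LANDED, `WindowTraceArch/Negative/LocalWeyl.lean`) with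
`∃ C` moved in front of the family: its proof builds `C = (2L² + K + P + 1)/c` from the narrow bump
`exists_bump_lower (min (A/2) (log 2/2) (1/2))` alone, so the same proof goes through verbatim. -/
theorem stub_upperLawUniform :
    ∀ A : ℝ, 0 < A → ∃ C : ℝ, 0 < C ∧
      ∀ (ι : Type) (γ : ι → ℝ),
        (∀ g : ℝ → ℂ, Literature.NumberTheory.LFunctions.IsWeilTest g →
          tsupport g ⊆ Set.Icc (-A) A →
            HasSum (fun i => Literature.NumberTheory.LFunctions.weilMellin g (1 / 2 + (γ i : ℂ) * Complex.I))
              (Literature.NumberTheory.LFunctions.weilFunctional g)) →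
        ∀ (T : ℝ) (s : Finset ι), (∀ i ∈ s, |γ i - T| ≤ 1) →
          (s.card : ℝ) ≤ C * (1 + Real.log (1 + |T|)) :=
  Summit.RiemannHypothesis.RiemannHypothesis.Theorems.SpectralTraceWindowStep.stub_upperLawUniform

/-- **stub_archFloor — the archimedean floor of `Re Q` along modulates (RH-FREE, M).** For a Weil
test `w` supported in `[-(log 2)/2, (log 2)/2]` (so NO prime enters `Q(w_T)`:
`weilQuadratic_re_eq_weilArchQuadratic`) there is `K = K(w)` with
`(P/2π) log(1+|T|) − K ≤ Re Q(w_T)` for every `T`, where `w_T(t) = e^{-iTt} w(t)` and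
`P = ∫ |ŵ(1/2+iv)|² dv`. Proof route (the upper bound of `LocalWeyl.lean` run downward):
`Re Q(w_T) = 2 Re(ŵ_T(0) conj ŵ_T(1)) − log π ‖w‖₂² + (1/2π) ∫ |ŵ(1/2+i(u−T))|² Re ψ(1/4+iu/2) du`;
polar `≥ −2 (weilL1 w)²` (`norm_weilMellin_le_weilL1`, `norm_modulate`); archimedean: the minorant
`σ_T(u) := log(1+|T|) − log(1+|u−T|) − 6 ≤ log(1+|u|) − 6 ≤ Re ψ(1/4+iu/2)` (lower Stirling
`log_norm_sub_le_re_digamma` for `|u| ≥ 1`, `reDigammaQuarter_mono` + `re_digamma_one_quarter_ge`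
for `|u| ≤ 1`) in `integral_norm_sq_weilMellin_mul_mono`, then `integral_sub_right_eq_self`. -/
theorem stub_archFloor :
    ∀ w : ℝ → ℂ, Literature.NumberTheory.LFunctions.IsWeilTest w →
      tsupport w ⊆ Set.Icc (-(Real.log 2 / 2)) (Real.log 2 / 2) →
        ∃ K : ℝ, ∀ T : ℝ,
          1 / (2 * Real.pi) *
                (∫ v : ℝ, ‖Literature.NumberTheory.LFunctions.weilMellin w (1 / 2 + v * Complex.I)‖ ^ 2) *
              Real.log (1 + |T|) - K ≤
            (Literature.NumberTheory.LFunctions.weilQuadratic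
              (fun t : ℝ => Complex.exp (-((T * t : ℝ) : ℂ) * Complex.I) * w t)).re :=
  Summit.RiemannHypothesis.RiemannHypothesis.Theorems.SpectralTraceWindowStep.stub_archFloor

/-- **stub_farTail — far atoms carry little of a fixed transform (RH-FREE, M).** Given the uniform
upper law: for `A > 0`, a Weil test `w` and `ε > 0` there is `R > 0` such that for EVERY real family
`γ` reproducing `W` on the Weil tests of `[-A, A]`, every `T` and every finite set `F` of indices with
`|γ_i − T| > R`: `Σ_{i∈F} |ŵ(1/2+i(γ_i−T))|² ≤ ε (1 + log(1+|T|))`. Proof route: sort `F` into the unit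
windows around `T + m`, `m = round(γ_i − T) ∈ ℤ`, `|m| ≥ R − 1`; each holds `≤ C(1 + log(1+|T+m|)) ≤
C (1 + log(1+|T|))(1 + log(1+|m|))` indices (uniform upper law) and each index costs
`≤ D²/(1+(γ_i−T)²)² ≤ D²/((1+R²)(1+(|m|−1)²))` (`norm_sq_weilMellin_half_line_le`, `D = weilDecayW 0 w`);
the series `Σ_m (1 + log(1+|m|))/(1+(|m|−1)²)` converges, so `R` large (in terms of `A, w, ε`) does it. -/
theorem stub_farTail :
    (∀ A : ℝ, 0 < A → ∃ C : ℝ, 0 < C ∧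
      ∀ (ι : Type) (γ : ι → ℝ),
        (∀ g : ℝ → ℂ, Literature.NumberTheory.LFunctions.IsWeilTest g →
          tsupport g ⊆ Set.Icc (-A) A →
            HasSum (fun i => Literature.NumberTheory.LFunctions.weilMellin g (1 / 2 + (γ i : ℂ) * Complex.I))
              (Literature.NumberTheory.LFunctions.weilFunctional g)) →
        ∀ (T : ℝ) (s : Finset ι), (∀ i ∈ s, |γ i - T| ≤ 1) →
          (s.card : ℝ) ≤ C * (1 + Real.log (1 + |T|))) →
    ∀ A : ℝ, 0 < A → ∀ w : ℝ → ℂ, Literature.NumberTheory.LFunctions.IsWeilTest w →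
      ∀ ε : ℝ, 0 < ε → ∃ R : ℝ, 0 < R ∧
        ∀ (ι : Type) (γ : ι → ℝ),
          (∀ g : ℝ → ℂ, Literature.NumberTheory.LFunctions.IsWeilTest g →
            tsupport g ⊆ Set.Icc (-A) A →
              HasSum (fun i => Literature.NumberTheory.LFunctions.weilMellin g (1 / 2 + (γ i : ℂ) * Complex.I))
                (Literature.NumberTheory.LFunctions.weilFunctional g)) →
          ∀ (T : ℝ) (F : Finset ι), (∀ i ∈ F, R < |γ i - T|) →
            ∑ i ∈ F, ‖Literature.NumberTheory.LFunctions.weilMellin w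
                (1 / 2 + ((γ i - T : ℝ) : ℂ) * Complex.I)‖ ^ 2 ≤
              ε * (1 + Real.log (1 + |T|)) :=
  Summit.RiemannHypothesis.RiemannHypothesis.Theorems.SpectralTraceWindowStep.stub_farTail

/-- **The corridor from its three pieces** (sorry-free glue). Fix the narrow bump `w` of
`exists_bump_lower` (width `δ = min (A/2) (log 2/2) (1/2)`), `P = ∫|ŵ|² ≥ 2c > 0`,
`L = weilL1 w` (`L² ≥ c`). For a family `γ` and a height `T`, `Σ_i |ŵ_T(1/2+iγ_i)|² = Re Q(w_T)`
(`hasSum_norm_sq_of_windowTrace`), so some finite partial sum exceeds `Re Q(w_T) − 1 ≥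
(P/2π) log(1+|T|) − K − 1` (`stub_archFloor`); its far part (`|γ_i − T| > R`) is
`≤ (P/4π)(1 + log(1+|T|))` (`stub_farTail` with `ε = P/4π`), and each near term is `≤ L²`; hence
`#near · L² ≥ (P/4π) log(1+|T|) − (K + 1 + P/4π)`. [folklore] -/
theorem rungCorridor_of_pieces (hUL : UpperLawUniformStatement) (hAF : ArchFloorStatement)
    (hFT : FarTailStatement) : RungCorridorStatement := by
  intro A hA
  classical
  -- the narrow bump (no prime enters: width ≤ (log 2)/2)
  set δ : ℝ := min (A / 2) (min (Real.log 2 / 2) (1 / 2)) with hδ_def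
  have hlog2 : 0 < Real.log 2 := Real.log_pos one_lt_two
  have hδ : 0 < δ := lt_min (half_pos hA) (lt_min (half_pos hlog2) one_half_pos)
  have hδA : δ ≤ A / 2 := min_le_left _ _
  have hδl : δ ≤ Real.log 2 / 2 := (min_le_right _ _).trans (min_le_left _ _)
  have hδ1 : δ ≤ 1 / 2 := (min_le_right _ _).trans (min_le_right _ _)
  obtain ⟨w, hw, hws, -, c, hc, hlow⟩ := exists_bump_lower hδ hδ1
  have hwsl : tsupport w ⊆ Icc (-(Real.log 2 / 2)) (Real.log 2 / 2) :=
    hws.trans (Icc_subset_Icc (by linarith) hδl)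
  -- constants of the bump
  set L : ℝ := weilL1 w with hL
  set P : ℝ := ∫ v : ℝ, ‖weilMellin w (1 / 2 + v * I)‖ ^ 2 with hP
  have hL2 : c ≤ L ^ 2 := by
    have h1 : ‖weilMellin w (1 / 2 + ((0 : ℝ) : ℂ) * I)‖ ≤ L :=
      norm_weilMellin_le_weilL1 hw.1.continuous hw.2 (by simp) (by norm_num)
    have h2 := hlow 0 (by simp)
    have h0 : 0 ≤ ‖weilMellin w (1 / 2 + ((0 : ℝ) : ℂ) * I)‖ := norm_nonneg _
    nlinarith
  have hLpos : 0 < L ^ 2 := lt_of_lt_of_le hc hL2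
  have hPpos : 0 < P := by
    have hint := integrable_norm_sq_weilMellin_half_line hw
    have h1 : ∫ _ in Icc (-1 : ℝ) 1, c ≤
        ∫ v in Icc (-1 : ℝ) 1, ‖weilMellin w (1 / 2 + v * I)‖ ^ 2 := by
      refine setIntegral_mono_on continuous_const.integrableOn_Icc hint.integrableOn
        measurableSet_Icc fun v hv => ?_
      exact hlow v (abs_le.2 ⟨by linarith [hv.1], hv.2⟩)
    have h2 : ∫ v in Icc (-1 : ℝ) 1, ‖weilMellin w (1 / 2 + v * I)‖ ^ 2 ≤ P :=
      setIntegral_le_integral hint (Filter.Eventually.of_forall fun _ => by positivity)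
    have h3 : ∫ _ in Icc (-1 : ℝ) 1, c = 2 * c := by
      rw [setIntegral_const, Real.volume_real_Icc_of_le (by norm_num), smul_eq_mul]
      ring
    linarith
  -- the archimedean floor and the far tail for this bump
  obtain ⟨K, hK⟩ := hAF w hw hwsl
  set e : ℝ := P / (4 * π) with he
  have hε : 0 < e := by positivity
  obtain ⟨R, hR, hfar⟩ := hFT hUL A hA w hw e hε
  refine ⟨R, e / L ^ 2, (|K| + 1 + e) / L ^ 2, hR, by positivity, ?_⟩
  intro ι γ hγ T
  set ℓ : ℝ := Real.log (1 + |T|) with hℓ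
  -- the modulated test `w_T`
  set wT : ℝ → ℂ := fun t => cexp (-((T * t : ℝ) : ℂ) * I) * w t with hwT_def
  have hwT : IsWeilTest wT := isWeilTest_modulate hw T
  have hwTsA : tsupport wT ⊆ Icc (-(A / 2)) (A / 2) :=
    ((tsupport_modulate_subset w T).trans hws).trans (Icc_subset_Icc (by linarith) hδA)
  have hsum := hasSum_norm_sq_of_windowTrace hγ hwT hwTsA
  set Q : ℝ := (weilQuadratic wT).re with hQ_def
  -- a finite partial sum within `1` of the total
  obtain ⟨s₀, hs₀⟩ : ∃ s₀ : Finset ι,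
      Q - 1 < ∑ i ∈ s₀, ‖weilMellin wT (1 / 2 + (γ i : ℂ) * I)‖ ^ 2 := by
    have ht : Filter.Tendsto
        (fun s : Finset ι => ∑ i ∈ s, ‖weilMellin wT (1 / 2 + (γ i : ℂ) * I)‖ ^ 2)
        Filter.atTop (𝓝 Q) := hsum
    exact (ht.eventually (Ioi_mem_nhds (by linarith : Q - 1 < Q))).exists
  -- split near / far
  set sN : Finset ι := s₀.filter (fun i => |γ i - T| ≤ R) with hsN
  set sF : Finset ι := s₀.filter (fun i => ¬ |γ i - T| ≤ R) with hsF
  have hsplit : ∑ i ∈ s₀, ‖weilMellin wT (1 / 2 + (γ i : ℂ) * I)‖ ^ 2 =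
      ∑ i ∈ sN, ‖weilMellin wT (1 / 2 + (γ i : ℂ) * I)‖ ^ 2 +
        ∑ i ∈ sF, ‖weilMellin wT (1 / 2 + (γ i : ℂ) * I)‖ ^ 2 :=
    (Finset.sum_filter_add_sum_filter_not s₀ _ _).symm
  -- near: each term `≤ L²`
  have hLT : weilL1 wT = L := by
    rw [hL, weilL1, weilL1]
    refine integral_congr_ae (Filter.Eventually.of_forall fun t => ?_)
    simp only [hwT_def, norm_modulate]
  have hnear : ∑ i ∈ sN, ‖weilMellin wT (1 / 2 + (γ i : ℂ) * I)‖ ^ 2 ≤ (sN.card : ℝ) * L ^ 2 := by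
    have hterm : ∀ i ∈ sN, ‖weilMellin wT (1 / 2 + (γ i : ℂ) * I)‖ ^ 2 ≤ L ^ 2 := by
      intro i _
      have h1 : ‖weilMellin wT (1 / 2 + (γ i : ℂ) * I)‖ ≤ L := by
        rw [← hLT]
        exact norm_weilMellin_le_weilL1 hwT.1.continuous hwT.2 (by simp) (by norm_num)
      exact pow_le_pow_left₀ (norm_nonneg _) h1 2
    calc ∑ i ∈ sN, ‖weilMellin wT (1 / 2 + (γ i : ℂ) * I)‖ ^ 2 ≤ ∑ _i ∈ sN, L ^ 2 :=
          Finset.sum_le_sum hterm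
      _ = (sN.card : ℝ) * L ^ 2 := by rw [Finset.sum_const, nsmul_eq_mul]
  -- far: the tail stub
  have hfar' : ∑ i ∈ sF, ‖weilMellin wT (1 / 2 + (γ i : ℂ) * I)‖ ^ 2 ≤ e * (1 + ℓ) := by
    have hmod : ∀ i, weilMellin wT (1 / 2 + (γ i : ℂ) * I) =
        weilMellin w (1 / 2 + ((γ i - T : ℝ) : ℂ) * I) := fun i => weilMellin_modulate w T (γ i)
    simp only [hmod]
    refine hfar ι γ hγ T sF fun i hi => ?_
    exact lt_of_not_ge (Finset.mem_filter.1 hi).2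
  -- the archimedean floor for the total
  have hQ : 2 * (e * ℓ) - K ≤ Q := by
    have h1 := hK T
    have h2 : 1 / (2 * π) * P * ℓ = 2 * (e * ℓ) := by
      simp only [he]
      field_simp
      ring
    rw [h2] at h1
    exact h1
  -- assemble
  refine ⟨sN, fun i hi => (Finset.mem_filter.1 hi).2, ?_⟩
  have hKabs : K ≤ |K| := le_abs_self K
  have hmain : e * ℓ - (|K| + 1 + e) ≤ (sN.card : ℝ) * L ^ 2 := by
    rw [hsplit] at hs₀
    linarith
  rw [div_mul_eq_mul_div, div_sub_div_same, div_le_iff₀ hLpos]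
  exact hmain

/-- **stub_rungCorridor — lower local Weyl law for window-trace families (RH-FREE; PROVED here from the
three registered pieces `stub_upperLawUniform`, `stub_archFloor`, `stub_farTail`).** For every `A > 0`
there are `R > 0`, `c > 0`, `C` such that every real family `γ` reproducing `W` on the Weil tests
supported in `[-A, A]` has, around EVERY height `T`, a finite set of at least `c·log(1+|T|) − C`
indices with `|γ_i − T| ≤ R`. Statement verbatim as registered by the planner (it is the hypothesis of
`stub_unitMargin` and the GapLemma input of line `ground-state-pinning`). -/
theorem stub_rungCorridor :
    ∀ A : ℝ, 0 < A → ∃ R c C : ℝ, 0 < R ∧ 0 < c ∧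
      ∀ (ι : Type) (γ : ι → ℝ),
        (∀ g : ℝ → ℂ, Literature.NumberTheory.LFunctions.IsWeilTest g →
          tsupport g ⊆ Set.Icc (-A) A →
            HasSum (fun i => Literature.NumberTheory.LFunctions.weilMellin g (1 / 2 + (γ i : ℂ) * Complex.I))
              (Literature.NumberTheory.LFunctions.weilFunctional g)) →
        ∀ T : ℝ, ∃ s : Finset ι, (∀ i ∈ s, |γ i - T| ≤ R) ∧
          c * Real.log (1 + |T|) - C ≤ (s.card : ℝ) :=
  rungCorridor_of_pieces stub_upperLawUniform stub_archFloor stub_farTail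

/-- **stub_unitMargin — unit atoms certify a positivity margin one rung ahead (the card's `U`;
RH-IMPLIED threshold claim; fed the corridor).** Given the lower local Weyl law: for every `n ≥ 2`, a
real unit-multiplicity family reproducing `W` on the Weil tests supported in `[-log n, log n]` forces
`WeilPositivityOn (log (n+2) / 2)`. Intended proof (the Christoffel squeeze): if `h` is a Weil test of
the half window `[-log(n+2)/2, log(n+2)/2]` with `Re Q(h) < 0`, then with `1 + η = log(n+2)/log n`
the dilate `h_η` is a test of `[-(log n)/2, (log n)/2]` and `Σ_i ‖(h_η)^(1/2+iγ_i)‖² = Re Q(h) +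
∫₀^η virial < ∫₀^η virial` on EVERY rung-`n` family (`squeeze_hasSum`, PROVED), squeezing all atoms
into the sublevel set of the stretched transform `t ↦ (1+η)^{-1}|ĥ(1/2 + it/(1+η))|²`
(`weilMellin_weilDilate_atom`), to be raced against the corridor (`stub_rungCorridor`) and the pinning
of atoms below the unit wall `2πn`. Status: in the threshold model of `Arch ∧ ¬RH` this is
`N‡ + 2 ≤ e^{2a⋆}`; implies `NoDegenerateEdge` of line `ground-state-pinning`; priced by the card's
experiment F2 (order of unit-death vs positivity-death, extended precision, NOT yet run). With
`WindowTraceArch` alone it yields only `WeilPositivityOn (log 2)` (`unitCertifiesMargin_windowTraceArch`). -/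
theorem stub_unitMargin :
    (∀ A : ℝ, 0 < A → ∃ R c C : ℝ, 0 < R ∧ 0 < c ∧
      ∀ (ι : Type) (γ : ι → ℝ),
        (∀ g : ℝ → ℂ, Literature.NumberTheory.LFunctions.IsWeilTest g →
          tsupport g ⊆ Set.Icc (-A) A →
            HasSum (fun i => Literature.NumberTheory.LFunctions.weilMellin g (1 / 2 + (γ i : ℂ) * Complex.I))
              (Literature.NumberTheory.LFunctions.weilFunctional g)) →
        ∀ T : ℝ, ∃ s : Finset ι, (∀ i ∈ s, |γ i - T| ≤ R) ∧
          c * Real.log (1 + |T|) - C ≤ (s.card : ℝ)) →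
    ∀ n : ℕ, 2 ≤ n →
      (∃ (ι : Type) (γ : ι → ℝ), ∀ g : ℝ → ℂ, Literature.NumberTheory.LFunctions.IsWeilTest g →
        tsupport g ⊆ Set.Icc (-Real.log (n : ℝ)) (Real.log (n : ℝ)) →
          HasSum (fun i => Literature.NumberTheory.LFunctions.weilMellin g (1 / 2 + (γ i : ℂ) * Complex.I))
            (Literature.NumberTheory.LFunctions.weilFunctional g)) →
      Literature.NumberTheory.LFunctions.WeilPositivityOn (Real.log ((n : ℝ) + 2) / 2) := by
  sorry

/-- **stub_positiveLadder — crystallisation from the seed under a positivity margin (RH-STRENGTH,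
HARDEST; the card's `C′` re-typed per TRIAGE-r2-1 F2).** For every `n ≥ 2`: from the archimedean seed
`WindowTraceArch` and `WeilPositivityOn (log (n+1) / 2)` (half a rung more than `Trace(log n)` itself
gives back), a real unit-multiplicity family reproducing `W` on the Weil tests supported in
`[-log n, log n]`. Kernel-checked equivalent to the card's `MarginRecrystallisation`
(`marginRecrystallisation_iff_positiveLadder`): the old family is logically idle beyond the seed.
Engines: those of the sibling cruxes `WindowTraceArch` / `WindowTracePrime2` (far-field frame synthesis
+ Newton–Kantorovich, designs by degree + compactness, causal level sets, pick-slope's Herglotz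
parametrisation — which exists precisely because positivity is GIVEN), none of which has to decide
a sign here. First contentful instance `n = 3`: `WindowTracePrime2` from `WeilPositivityOn (log 2)`
(`windowTracePrime2_of_positiveLadder`). Constraints: every genuine rung change reworks infinitely
many atoms at all heights (`Negative/BothWays`, `BelowHeight`). RH-implied; with `WindowTraceArch`
alone it proves nothing new (positivity beyond `log 3 / 2` is open). -/
theorem stub_positiveLadder :
    ∀ n : ℕ, 2 ≤ n →
      Summit.RiemannHypothesis.RiemannHypothesis.Theses.SpectralTrace.WindowTraceArch →
      Literature.NumberTheory.LFunctions.WeilPositivityOn (Real.log ((n : ℝ) + 1) / 2) →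
        ∃ (ι : Type) (γ : ι → ℝ), ∀ g : ℝ → ℂ, Literature.NumberTheory.LFunctions.IsWeilTest g →
          tsupport g ⊆ Set.Icc (-Real.log (n : ℝ)) (Real.log (n : ℝ)) →
            HasSum (fun i => Literature.NumberTheory.LFunctions.weilMellin g (1 / 2 + (γ i : ℂ) * Complex.I))
              (Literature.NumberTheory.LFunctions.weilFunctional g) := by
  sorry

/-! ## Consistency: each named statement IS its registered stub (definitionally) -/

theorem upperLawUniformStatement_holds : UpperLawUniformStatement := stub_upperLawUniform
theorem archFloorStatement_holds : ArchFloorStatement := stub_archFloor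
theorem farTailStatement_holds : FarTailStatement := stub_farTail
theorem rungCorridorStatement_holds : RungCorridorStatement := stub_rungCorridor
theorem unitMarginStatement_holds : UnitMarginStatement := stub_unitMargin
theorem positiveLadder_holds : PositiveLadder := stub_positiveLadder

/-! ## Name-keyed aliases (the hypotheses of the composition) -/
namespace Registered

/-- Alias of `UpperLawUniformStatement` keyed by the registered stub name. -/
abbrev stub_upperLawUniform : Prop := UpperLawUniformStatement
/-- Alias of `ArchFloorStatement` keyed by the registered stub name. -/
abbrev stub_archFloor : Prop := ArchFloorStatement
/-- Alias of `FarTailStatement` keyed by the registered stub name. -/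
abbrev stub_farTail : Prop := FarTailStatement
/-- Alias of `RungCorridorStatement` (derived: `rungCorridor_of_pieces`). -/
abbrev stub_rungCorridor : Prop := RungCorridorStatement
/-- Alias of `UnitMarginStatement` keyed by the registered stub name. -/
abbrev stub_unitMargin : Prop := UnitMarginStatement
/-- Alias of `PositiveLadder` keyed by the registered stub name. -/
abbrev stub_positiveLadder : Prop := PositiveLadder

end Registered

/-! ## First lemmas of the line (PROVED): the Christoffel squeeze across one collar -/

/-- **The squeeze, sum form.** Let `γ` reproduce `W` on the Weil tests supported in `[-A, A]`, let
`η > 0`, and let `h` be ANY Weil test supported in the larger half window `[-(1+η)A/2, (1+η)A/2]`.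
Bombieri's dilate `h_η = weilDilate η h` is a test of `[-A/2, A/2]`, so the family is a unit-weight
sampling measure for it (`hasSum_norm_sq_of_windowTrace`) and
`Σ_i ‖(h_η)^(1/2+iγ_i)‖² = Re Q(h_η) = Re Q(h) + ∫₀^η weilDilationVirial (h_s)/(1+s) ds`
(`re_weilQuadratic_weilDilate_eq_add_integral`). [folklore] -/
theorem squeeze_hasSum {A : ℝ} {ι : Type*} {γ : ι → ℝ}
    (hγ : ∀ g : ℝ → ℂ, IsWeilTest g → tsupport g ⊆ Icc (-A) A →
      HasSum (fun i => weilMellin g (1 / 2 + (γ i : ℂ) * I)) (weilFunctional g))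
    {h : ℝ → ℂ} (hh : IsWeilTest h) {η : ℝ} (hη : 0 < η)
    (hsupp : tsupport h ⊆ Icc (-((1 + η) * (A / 2))) ((1 + η) * (A / 2))) :
    HasSum (fun i => ‖weilMellin (weilDilate η h) (1 / 2 + (γ i : ℂ) * I)‖ ^ 2)
      ((weilQuadratic h).re +
        ∫ s in (0 : ℝ)..η, weilDilationVirial (weilDilate s h) / (1 + s)) := by
  have hη' : -1 < η := by linarith
  have hne : (1 + η) ≠ 0 := by linarith
  have hs := tsupport_weilDilate_subset h hη' hsupp
  rw [mul_div_cancel_left₀ _ hne] at hs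
  have hsum := hasSum_norm_sq_of_windowTrace hγ (hh.weilDilate hη') hs
  rwa [re_weilQuadratic_weilDilate_eq_add_integral hh hη'] at hsum

/-- **Negativity one collar up squeezes every atom of every rung family** (one-term truncation of
`squeeze_hasSum`, the card's first lemma): `‖(h_η)^(1/2+iγ_i)‖² ≤ Re Q(h) + ∫₀^η virial`.
[folklore] -/
theorem negativity_squeezes_atoms {A : ℝ} {ι : Type*} {γ : ι → ℝ}
    (hγ : ∀ g : ℝ → ℂ, IsWeilTest g → tsupport g ⊆ Icc (-A) A →
      HasSum (fun i => weilMellin g (1 / 2 + (γ i : ℂ) * I)) (weilFunctional g))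
    {h : ℝ → ℂ} (hh : IsWeilTest h) {η : ℝ} (hη : 0 < η)
    (hsupp : tsupport h ⊆ Icc (-((1 + η) * (A / 2))) ((1 + η) * (A / 2))) (i : ι) :
    ‖weilMellin (weilDilate η h) (1 / 2 + (γ i : ℂ) * I)‖ ^ 2 ≤
      (weilQuadratic h).re +
        ∫ s in (0 : ℝ)..η, weilDilationVirial (weilDilate s h) / (1 + s) :=
  le_hasSum (squeeze_hasSum hγ hh hη hsupp) i fun _ _ => by positivity

/-- If `Re Q(h) < 0` one collar up, every atom's squared (dilated) transform is below the virial
budget `∫₀^η virial` — the squeeze in the form the race uses. [folklore] -/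
theorem norm_sq_lt_virialBudget_of_neg {A : ℝ} {ι : Type*} {γ : ι → ℝ}
    (hγ : ∀ g : ℝ → ℂ, IsWeilTest g → tsupport g ⊆ Icc (-A) A →
      HasSum (fun i => weilMellin g (1 / 2 + (γ i : ℂ) * I)) (weilFunctional g))
    {h : ℝ → ℂ} (hh : IsWeilTest h) {η : ℝ} (hη : 0 < η)
    (hsupp : tsupport h ⊆ Icc (-((1 + η) * (A / 2))) ((1 + η) * (A / 2)))
    (hneg : (weilQuadratic h).re < 0) (i : ι) :
    ‖weilMellin (weilDilate η h) (1 / 2 + (γ i : ℂ) * I)‖ ^ 2 <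
      ∫ s in (0 : ℝ)..η, weilDilationVirial (weilDilate s h) / (1 + s) := by
  have h1 := negativity_squeezes_atoms hγ hh hη hsupp i
  linarith

/-- What positivity ALONE already gives one collar up (TRIAGE-r2-2's `nonneg_add_virial`): with NO
family, `WeilPositivityOn (A/2)` forces `0 ≤ Re Q(h) + ∫₀^η virial` for every test `h` of the larger
half window — so the unit family's surplus in `stub_unitMargin` is the DISTRIBUTION of the budget over
atoms the corridor forces to exist, not the sign of the budget. [folklore] -/
theorem nonneg_add_virialBudget_of_weilPositivityOn {A : ℝ} (hpos : WeilPositivityOn (A / 2))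
    {h : ℝ → ℂ} (hh : IsWeilTest h) {η : ℝ} (hη : 0 < η)
    (hsupp : tsupport h ⊆ Icc (-((1 + η) * (A / 2))) ((1 + η) * (A / 2))) :
    0 ≤ (weilQuadratic h).re +
      ∫ s in (0 : ℝ)..η, weilDilationVirial (weilDilate s h) / (1 + s) := by
  have hη' : -1 < η := by linarith
  have hne : (1 + η) ≠ 0 := by linarith
  have hs := tsupport_weilDilate_subset h hη' hsupp
  rw [mul_div_cancel_left₀ _ hne] at hs
  rw [← re_weilQuadratic_weilDilate_eq_add_integral hh hη']
  exact hpos _ (hh.weilDilate hη') hs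

/-- The transform of the dilate at an atom, at the CONTRACTED height `γ_i/(1+η)`:
`(h_η)^(1/2+it) = (1+η)^{1/2}(1+η)⁻¹ ĥ(1/2 + it/(1+η))`. [folklore] -/
theorem weilMellin_weilDilate_atom (h : ℝ → ℂ) {η : ℝ} (hη : 0 < η) (t : ℝ) :
    weilMellin (weilDilate η h) (1 / 2 + (t : ℂ) * I) =
      (Real.sqrt (1 + η) : ℂ) * ((1 + η : ℝ) : ℂ)⁻¹ *
        weilMellin h (1 / 2 + ((t : ℂ) * I) / ((1 + η : ℝ) : ℂ)) := by
  rw [weilMellin_weilDilate h (by linarith : (-1 : ℝ) < η)]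
  congr 2
  ring

/-- **Unit atoms need Christoffel room `≥ 1`.** For a family reproducing `W` on `[-A, A]`, `A > 0`,
and every atom `γ_j`: `1 ≤ λ_A(γ_j)` — every half-window test `h` with `ĥ(1/2+iγ_j) = 1` has
`1 = |ĥ(1/2+iγ_j)|² ≤ Re Q(h)` (`norm_sq_le_of_windowTrace`), and such tests exist (a modulated
narrow bump, `exists_bump_lower` + `weilMellin_modulate`, rescaled). [folklore] -/
theorem one_le_weilChristoffel_of_atom {A : ℝ} (hA : 0 < A) {ι : Type*} {γ : ι → ℝ}
    (hγ : ∀ g : ℝ → ℂ, IsWeilTest g → tsupport g ⊆ Icc (-A) A →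
      HasSum (fun i => weilMellin g (1 / 2 + (γ i : ℂ) * I)) (weilFunctional g)) (j : ι) :
    1 ≤ weilChristoffel A (γ j) := by
  -- every admissible value is `≥ 1`
  have hlb : ∀ x ∈ {x : ℝ | ∃ h : ℝ → ℂ, IsWeilTest h ∧ tsupport h ⊆ Icc (-(A / 2)) (A / 2) ∧
      weilMellin h (1 / 2 + ((γ j : ℝ) : ℂ) * I) = 1 ∧ x = (weilQuadratic h).re}, (1 : ℝ) ≤ x := by
    rintro x ⟨h, hh, hs, h1, rfl⟩
    have := norm_sq_le_of_windowTrace hγ hh hs j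
    rwa [h1, norm_one, one_pow] at this
  -- the set is nonempty: a modulated narrow bump, rescaled to transform `1` at `γ_j`
  have hδ : 0 < min (A / 2) (1 / 2) := lt_min (half_pos hA) one_half_pos
  have hδ1 : min (A / 2) (1 / 2) ≤ 1 / 2 := min_le_right _ _
  have hδA : min (A / 2) (1 / 2) ≤ A / 2 := min_le_left _ _
  obtain ⟨w, hw, hws, -, c, hc, hlow⟩ := exists_bump_lower hδ hδ1
  obtain ⟨z, hz⟩ : ∃ z : ℂ, z = weilMellin w (1 / 2 + ((0 : ℝ) : ℂ) * I) := ⟨_, rfl⟩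
  have hz0 : z ≠ 0 := by
    intro h0
    have h1 := hlow 0 (by simp)
    rw [← hz, h0] at h1
    simp at h1
    linarith
  -- the modulate `w_T(t) = e^{-iγ_j t} w(t)` has transform `ŵ(1/2 + i(u - γ_j))`
  have hwT_test : IsWeilTest (fun t : ℝ => cexp (-(((γ j) * t : ℝ) : ℂ) * I) * w t) :=
    isWeilTest_modulate hw (γ j)
  have hwT_supp : tsupport (fun t : ℝ => cexp (-(((γ j) * t : ℝ) : ℂ) * I) * w t) ⊆
      Icc (-(A / 2)) (A / 2) :=
    (tsupport_modulate_subset w (γ j)).trans (hws.trans (Icc_subset_Icc (by linarith) hδA))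
  have hval : weilMellin (fun t : ℝ => cexp (-(((γ j) * t : ℝ) : ℂ) * I) * w t)
      (1 / 2 + ((γ j : ℝ) : ℂ) * I) = z := by
    have h1 := weilMellin_modulate w (γ j) (γ j)
    simp only [sub_self] at h1
    rw [← hz] at h1
    exact h1
  -- rescale by `z⁻¹`
  have hh : IsWeilTest (fun t : ℝ => z⁻¹ * (cexp (-(((γ j) * t : ℝ) : ℂ) * I) * w t)) :=
    hwT_test.const_mul z⁻¹
  have hhs : tsupport (fun t : ℝ => z⁻¹ * (cexp (-(((γ j) * t : ℝ) : ℂ) * I) * w t)) ⊆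
      Icc (-(A / 2)) (A / 2) :=
    (tsupport_mul_subset_right
      (f := fun _ : ℝ => z⁻¹) (g := fun t : ℝ => cexp (-(((γ j) * t : ℝ) : ℂ) * I) * w t)).trans
      hwT_supp
  have hh1 : weilMellin (fun t : ℝ => z⁻¹ * (cexp (-(((γ j) * t : ℝ) : ℂ) * I) * w t))
      (1 / 2 + ((γ j : ℝ) : ℂ) * I) = 1 := by
    rw [weilMellin_const_mul, hval, inv_mul_cancel₀ hz0]
  have hne : {x : ℝ | ∃ h : ℝ → ℂ, IsWeilTest h ∧ tsupport h ⊆ Icc (-(A / 2)) (A / 2) ∧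
      weilMellin h (1 / 2 + ((γ j : ℝ) : ℂ) * I) = 1 ∧ x = (weilQuadratic h).re}.Nonempty :=
    ⟨_, _, hh, hhs, hh1, rfl⟩
  unfold weilChristoffel
  exact le_csInf hne hlb

/-! ## Calibration of the stubs (PROVED): honesty checks against Collapse / LoadBearing

(The card's two-line composition `windowStep_of_margin : U → C′ → WindowStep` is inlined in
`WindowStep_of` and in `windowStep_iff_unitCertifiesMargin_and_positiveLadder` below, so that
EXACTLY ONE theorem of this file has the crux as its conclusion — the registered skeleton.) -/

/-- `(log (k+1))/2 ≤ (log (k+2))/2`. -/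
theorem half_log_succ_le_half_log_succ_succ (k : ℕ) :
    Real.log ((k : ℝ) + 1) / 2 ≤ Real.log ((k : ℝ) + 2) / 2 := by
  have h0 : (0 : ℝ) < (k : ℝ) + 1 := by positivity
  have : Real.log ((k : ℝ) + 1) ≤ Real.log ((k : ℝ) + 2) := Real.log_le_log h0 (by linarith)
  linarith

/-- Cast bookkeeping: `((k+1 : ℕ) : ℝ) + 1 = k + 2`. -/
theorem cast_succ_add_one (k : ℕ) : ((k + 1 : ℕ) : ℝ) + 1 = (k : ℝ) + 2 := by
  push_cast
  ring

/-- Cast bookkeeping: `((k+1 : ℕ) : ℝ) = k + 1`. -/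
theorem cast_succ' (k : ℕ) : ((k + 1 : ℕ) : ℝ) = (k : ℝ) + 1 := by
  push_cast
  ring

/-- `PositiveLadder → MarginRecrystallisation`: the registered synthesis stub gives the card's `C′`
(the old family enters only as the seed, `seed_of_rung`). [folklore] -/
theorem marginRecrystallisation_of_positiveLadder (hPL : PositiveLadder) :
    MarginRecrystallisation := by
  intro n hn hT hpos
  have hArch : WindowTraceArch := seed_of_rung hn hT
  have h := hPL (n + 1) (by omega) hArch
  rw [cast_succ_add_one, cast_succ'] at h
  exact h hpos

/-- `MarginRecrystallisation → PositiveLadder` (induction on the rung, positivity antitone): so the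
re-typing loses nothing (TRIAGE-r2-1 F2). [folklore] -/
theorem positiveLadder_of_marginRecrystallisation (hMR : MarginRecrystallisation) :
    PositiveLadder := by
  intro n hn
  induction n, hn using Nat.le_induction with
  | base =>
    intro hArch _
    have e2 : ((2 : ℕ) : ℝ) = 2 := by norm_num
    rw [e2]
    exact hArch
  | succ k hk ih =>
    intro hArch hpos
    rw [cast_succ_add_one] at hpos
    rw [cast_succ']
    have hk' : WTrace (Real.log (k : ℝ)) :=
      ih hArch (hpos.mono (half_log_succ_le_half_log_succ_succ k))
    exact hMR k hk hk' hpos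

/-- The re-typing is exact. [folklore] -/
theorem marginRecrystallisation_iff_positiveLadder :
    MarginRecrystallisation ↔ PositiveLadder :=
  ⟨positiveLadder_of_marginRecrystallisation, marginRecrystallisation_of_positiveLadder⟩

/-- **Non-collapse of `U`**: with the seed alone, `U` buys `WeilPositivityOn (log 4 / 2)` — i.e.
positivity on `[-log 2, log 2]`, beyond the tree's certified `log 3 / 2` — and nothing more without
crystallisation. [folklore] -/
theorem unitCertifiesMargin_windowTraceArch (hU : UnitCertifiesMargin) (hArch : WindowTraceArch) :
    WeilPositivityOn (Real.log 4 / 2) := by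
  have h := hU 2 le_rfl (by exact_mod_cast hArch)
  norm_num at h
  exact h

/-- **First contentful instance of `stub_positiveLadder`** (`n = 3`): the sibling crux
`WindowTracePrime2 = Trace(log 3)` from the seed and `WeilPositivityOn (log 2)` (`= log 4 / 2`).
[folklore] -/
theorem windowTracePrime2_of_positiveLadder (hPL : PositiveLadder) (hArch : WindowTraceArch)
    (hpos : WeilPositivityOn (Real.log 2)) : WindowTracePrime2 := by
  have h := hPL 3 (by norm_num) hArch
  have e3 : ((3 : ℕ) : ℝ) = 3 := by norm_num
  rw [e3] at h
  have e4 : Real.log ((3 : ℝ) + 1) / 2 = Real.log 2 := by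
    rw [show (3 : ℝ) + 1 = 2 ^ 2 by norm_num, Real.log_pow]
    push_cast
    ring
  rw [e4] at h
  exact h hpos

/-- **`U` excludes a conjugate point at or below `log(n+2)/2` once rung `n` is traced** — the one-line
shadow of TRIAGE-r2-1 F4 (`U → NoDegenerateEdge` of line `ground-state-pinning`), via the proved
strict antitonicity of `ε = weilGroundEnergy` (`not_weilPositivityOn_of_conjugatePoint_lt`).
[folklore] -/
theorem no_conjugatePoint_of_unitCertifiesMargin (hU : UnitCertifiesMargin) {n : ℕ} (hn : 2 ≤ n)
    (hT : WTrace (Real.log (n : ℝ))) {aStar : ℝ} (haStar : 0 < aStar)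
    (hlt : aStar < Real.log ((n : ℝ) + 2) / 2) : weilGroundEnergy aStar ≠ 0 := fun h0 =>
  not_weilPositivityOn_of_conjugatePoint_lt haStar h0 hlt (hU n hn hT)

/-- **Both RH-bearing stubs are crux-implied** (so neither can be "stronger than RH and false",
floor-feedback's death): the crux gives `U` … [folklore] -/
theorem unitCertifiesMargin_of_windowStep (hStep : WindowStep) : UnitCertifiesMargin := by
  intro n hn hT
  have h1 := hStep n hn hT
  have h2 := hStep (n + 1) (by omega) (by rw [cast_succ']; exact h1)
  rw [cast_succ_add_one] at h2
  exact Summit.RiemannHypothesis.RiemannHypothesis.Theorems.windowTraceToPositivity_proof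
    (Real.log ((n : ℝ) + 2)) h2

/-- … and `PositiveLadder` (every rung from the seed, positivity unused). [folklore] -/
theorem positiveLadder_of_windowStep (hStep : WindowStep) : PositiveLadder := by
  intro n hn hArch _
  exact rungs_of_windowTraceArch_of_windowStep hArch hStep n hn

/-- **The line is an EXACT conjunction of the crux** (the only shape `Collapse` permits; TRIAGE-r2-2's
`windowStep_iff_margin` with `C′` re-typed): `WindowStep ↔ U ∧ PositiveLadder`. [folklore] -/
theorem windowStep_iff_unitCertifiesMargin_and_positiveLadder :
    WindowStep ↔ (UnitCertifiesMargin ∧ PositiveLadder) :=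
  ⟨fun h => ⟨unitCertifiesMargin_of_windowStep h, positiveLadder_of_windowStep h⟩,
    fun h n hn hT => (marginRecrystallisation_of_positiveLadder h.2) n hn hT (h.1 n hn hT)⟩

/-- At `n = 0, 1` the statement of `stub_unitMargin` is already a theorem (the rungs `log 0 = log 1
= 0` are free and the conclusions `WeilPositivityOn (log 2 / 2)`, `(log 3 / 2)` are certified in the
tree): the binder `2 ≤ n` carries no weight INSIDE `U` (LoadBearing H1 is honoured structurally, by
`stub_positiveLadder` taking the seed as input). [folklore] -/
theorem unitCertifiesMargin_zero_one :
    WeilPositivityOn (Real.log ((0 : ℕ) + 2 : ℝ) / 2) ∧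
      WeilPositivityOn (Real.log ((1 : ℕ) + 2 : ℝ) / 2) := by
  have h3 : WeilPositivityOn (Real.log 3 / 2) := weilPositivityOn_log_three_half
  refine ⟨?_, ?_⟩
  · have e : ((0 : ℕ) + 2 : ℝ) = 2 := by norm_num
    rw [e]
    refine h3.mono ?_
    have h23 : Real.log 2 ≤ Real.log 3 := Real.log_le_log (by norm_num) (by norm_num)
    linarith
  · have e : ((1 : ℕ) + 2 : ℝ) = 3 := by norm_num
    rw [e]
    exact h3

/-- Likewise the statement of `stub_positiveLadder` at `n = 0, 1` is free: the rungs
`log 0 = log 1 = 0` carry only the zero test (`Negative/LoadBearing.lean`). [folklore] -/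
theorem positiveLadder_zero_one :
    (WTrace (Real.log ((0 : ℕ) : ℝ))) ∧ (WTrace (Real.log ((1 : ℕ) : ℝ))) :=
  ⟨windowTrace_log_zero, windowTrace_log_one⟩

/-! ## The kernel-checked composition: the two open registered stubs imply the crux, by name -/

/-- **The line concludes the crux BY NAME** (pure logic; no `sorry`). From `Trace(log n)`:
the corridor is the theorem `stub_rungCorridor` (its three RH-free pieces are LANDED),
`WeilPositivityOn (log (n+2) / 2)` by `stub_unitMargin` fed the corridor; the seed by `seed_of_rung`;
`Trace(log (n+1))` by `stub_positiveLadder` at `n + 1`. -/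
theorem WindowStep_of (hU : Registered.stub_unitMargin) (hPL : Registered.stub_positiveLadder) :
    Summit.RiemannHypothesis.RiemannHypothesis.Theses.SpectralTrace.WindowStep := by
  intro n hn hT
  -- the corridor is a THEOREM now (`stub_rungCorridor`, from the three landed pieces);
  -- `U` fed the corridor: positivity one rung ahead; `PositiveLadder` (as `C′`): the next rung
  exact (marginRecrystallisation_of_positiveLadder hPL) n hn hT (hU stub_rungCorridor n hn hT)

/-- Wiring check: the registered stubs feed `WindowStep_of` as stated (an `example`, so that no
sorry-tainted DECLARATION of this file has the crux as its type). -/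
example : Summit.RiemannHypothesis.RiemannHypothesis.Theses.SpectralTrace.WindowStep :=
  WindowStep_of stub_unitMargin stub_positiveLadder

end Summit.RiemannHypothesis.RiemannHypothesis.Cruxes.WindowStep.ChristoffelMargin

end
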